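import Mathlib

/-!
# Crux `NormalFamilyBound` (stmt-Parity-9769), line `Sketch` (renewal-phase-bootstrap): stub `stub_arcBarrier`

The ARC BARRIER lemma (phase derivative + one-sided Grönwall) used by both transfers of the line: a complex
polynomial stays below a differentiable barrier `e^{b(φ)}` along an arc `φ ↦ r e^{iφ}` if it starts below it and,
wherever it is strictly above, the angular derivative `−Im(z P'(z)/P(z))` of `log ‖P(re^{iφ})‖` is at most `b'(φ)`.
Everything here is PROVED (supports stmt-Parity-9769; registered stub of the line skeleton
`Cruxes/NormalFamilyBound/Lines/Sketch.lean`).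

Proof layout: a real one-sided barrier principle for the gauge `v = ‖F‖² e^{-2b}` (last point below the
barrier via `sSup`, then monotonicity from the sign of the derivative), the derivative of the arc
`φ ↦ P(r e^{iφ})`, and the inner-product identity `⟪p, q (w I)⟫_ℝ = ‖p‖² (−Im (w q / p))` turning the
hypothesis on `−Im(z P'/P)` into the sign of `v'`.
-/

namespace Summit.Parity.BatemanHorn.Cruxes.NormalFamilyBound.RenewalPhaseBootstrap

open Polynomial

noncomputable section

/-- Real one-sided barrier principle: a function continuous on `[a, c]`, at most `1` at `a`, and having a
nonpositive derivative at every interior point where it exceeds `1`, is at most `1` on all of `[a, c]`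
(take the supremum of the points below the barrier before a violation, then use monotonicity from the
sign of the derivative on the remaining interval). -/
theorem arcBarrier_real_barrier {v : ℝ → ℝ} {a c : ℝ} (hv : ContinuousOn v (Set.Icc a c))
    (ha : v a ≤ 1)
    (hder : ∀ x ∈ Set.Ioo a c, 1 < v x → ∃ d : ℝ, HasDerivAt v d x ∧ d ≤ 0) :
    ∀ x ∈ Set.Icc a c, v x ≤ 1 := by
  intro x₁ hx₁
  by_contra hlt
  have hlt : 1 < v x₁ := not_le.mp hlt
  set S : Set ℝ := Set.Icc a x₁ ∩ v ⁻¹' Set.Iic 1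
  have hSc : IsClosed S :=
    (hv.mono (Set.Icc_subset_Icc_right hx₁.2)).preimage_isClosed_of_isClosed isClosed_Icc
      isClosed_Iic
  have hSne : S.Nonempty := ⟨a, Set.left_mem_Icc.mpr hx₁.1, ha⟩
  have hSbdd : BddAbove S := ⟨x₁, fun y hy => hy.1.2⟩
  have hsS : sSup S ∈ S := hSc.csSup_mem hSne hSbdd
  have has : a ≤ sSup S := hsS.1.1
  have hs_le : sSup S ≤ x₁ := hsS.1.2
  have hvs : v (sSup S) ≤ 1 := hsS.2
  have habove : ∀ y ∈ Set.Ioc (sSup S) x₁, 1 < v y := by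
    intro y hy
    by_contra hle
    have hyS : y ∈ S := ⟨⟨has.trans hy.1.le, hy.2⟩, not_lt.mp hle⟩
    exact absurd (le_csSup hSbdd hyS) (not_le.mpr hy.1)
  have hanti : AntitoneOn v (Set.Icc (sSup S) x₁) := by
    refine antitoneOn_of_deriv_nonpos (convex_Icc _ _) (hv.mono (Set.Icc_subset_Icc has hx₁.2))
      ?_ ?_
    · rw [interior_Icc]
      intro y hy
      obtain ⟨d, hd, -⟩ :=
        hder y ⟨has.trans_lt hy.1, hy.2.trans_le hx₁.2⟩ (habove y ⟨hy.1, hy.2.le⟩)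
      exact hd.differentiableAt.differentiableWithinAt
    · rw [interior_Icc]
      intro y hy
      obtain ⟨d, hd, hd0⟩ :=
        hder y ⟨has.trans_lt hy.1, hy.2.trans_le hx₁.2⟩ (habove y ⟨hy.1, hy.2.le⟩)
      rw [hd.deriv]
      exact hd0
  have hfin := hanti (Set.left_mem_Icc.mpr hs_le) (Set.right_mem_Icc.mpr hs_le) hs_le
  linarith

/-- Barrier principle for a differentiable complex path `F`: if `‖F a‖ ≤ e^{b(a)}` and, at each interior
point where `‖F‖` exceeds `e^{b}`, one has `⟪F, F'⟫_ℝ ≤ ‖F‖² b'` (i.e. `(log ‖F‖)' ≤ b'`), then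
`‖F‖ ≤ e^{b}` on `[a, c]`. Proved through the gauge `‖F‖² e^{-2b}` and `arcBarrier_real_barrier`. -/
theorem arcBarrier_path {F F' : ℝ → ℂ} {b b' : ℝ → ℝ} {a c : ℝ}
    (hF : ∀ x, HasDerivAt F (F' x) x) (hb : ∀ x ∈ Set.Icc a c, HasDerivAt b (b' x) x)
    (ha : ‖F a‖ ≤ Real.exp (b a))
    (hbound : ∀ x ∈ Set.Ioo a c, Real.exp (b x) < ‖F x‖ →
      inner ℝ (F x) (F' x) ≤ ‖F x‖ ^ 2 * b' x) :
    ∀ x ∈ Set.Icc a c, ‖F x‖ ≤ Real.exp (b x) := by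
  have hiff : ∀ x, ‖F x‖ ^ 2 * Real.exp (-2 * b x) ≤ 1 ↔ ‖F x‖ ≤ Real.exp (b x) := by
    intro x
    have hE : Real.exp (-2 * b x) = (Real.exp (b x) ^ 2)⁻¹ := by
      rw [sq, ← Real.exp_add, ← Real.exp_neg]
      congr 1
      ring
    rw [hE, mul_inv_le_iff₀ (pow_pos (Real.exp_pos _) 2), one_mul,
      sq_le_sq₀ (norm_nonneg _) (Real.exp_pos _).le]
  have hvc : ContinuousOn (fun x => ‖F x‖ ^ 2 * Real.exp (-2 * b x)) (Set.Icc a c) :=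
    ContinuousOn.fun_mul (fun x _ => (hF x).norm_sq.continuousAt.continuousWithinAt)
      (ContinuousOn.rexp
        (continuousOn_const.fun_mul fun x hx => (hb x hx).continuousAt.continuousWithinAt))
  have key := arcBarrier_real_barrier hvc ((hiff a).mpr ha) (by
    intro x hx h1
    have hlt : Real.exp (b x) < ‖F x‖ := not_le.mp fun h => (not_le.mpr h1) ((hiff x).mpr h)
    have hbx := hb x ⟨hx.1.le, hx.2.le⟩
    refine ⟨_, (hF x).norm_sq.fun_mul ((hbx.const_mul (-2)).exp), ?_⟩
    have hI := hbound x hx hlt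
    have hE := Real.exp_pos (-2 * b x)
    nlinarith [mul_le_mul_of_nonneg_right hI hE.le])
  intro x hx
  exact (hiff x).mp (key x hx)

/-- The angular derivative in inner-product form: for `p ≠ 0`,
`⟪p, q (w I)⟫_ℝ = ‖p‖² (−Im (w q / p))`. -/
theorem arcBarrier_inner_eq (p q w : ℂ) (hp : p ≠ 0) :
    inner ℝ p (q * (w * Complex.I)) = ‖p‖ ^ 2 * -((w * q / p).im) := by
  have hc : (starRingEnd ℂ) p = ((‖p‖ ^ 2 : ℝ) : ℂ) / p := by
    rw [eq_div_iff hp, ← Complex.normSq_eq_norm_sq, mul_comm, Complex.mul_conj]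
  have hI : q * (w * Complex.I) * (starRingEnd ℂ) p
      = ((‖p‖ ^ 2 : ℝ) : ℂ) * (w * q / p * Complex.I) := by
    rw [hc]
    ring
  rw [Complex.inner, hI, Complex.re_ofReal_mul, Complex.mul_I_re]

/-- Derivative of the arc `φ ↦ r e^{iφ}`: it is `i · r e^{iφ}`. -/
theorem arcBarrier_hasDerivAt_arc (r φ : ℝ) :
    HasDerivAt (fun t : ℝ => (r : ℂ) * Complex.exp ((t : ℂ) * Complex.I))
      ((r : ℂ) * Complex.exp ((φ : ℂ) * Complex.I) * Complex.I) φ := by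
  have h1 : HasDerivAt (fun t : ℝ => (t : ℂ)) 1 φ := by
    simpa using (hasDerivAt_id φ).ofReal_comp
  exact (((h1.mul_const Complex.I).cexp).const_mul (r : ℂ)).congr_deriv (by ring)

/-- Derivative of `φ ↦ P(r e^{iφ})` along the arc: `P'(z) · (z i)` with `z = r e^{iφ}` (chain rule over the
real-to-complex path). -/
theorem arcBarrier_hasDerivAt_eval (P : Polynomial ℂ) (r φ : ℝ) :
    HasDerivAt (fun t : ℝ => P.eval ((r : ℂ) * Complex.exp ((t : ℂ) * Complex.I)))
      ((Polynomial.derivative P).eval ((r : ℂ) * Complex.exp ((φ : ℂ) * Complex.I)) *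
        ((r : ℂ) * Complex.exp ((φ : ℂ) * Complex.I) * Complex.I)) φ :=
  (P.hasDerivAt _).comp φ (arcBarrier_hasDerivAt_arc r φ)

/-- STUB (provable now; phase derivative + one-sided Grönwall): the ARC BARRIER lemma. For a complex polynomial `P`,
a radius `r > 0` and a differentiable barrier `b` on `[φ₀, φ₁]`: if `‖P(re^{iφ₀})‖ ≤ e^{b(φ₀)}` and, at every interior
angle where `‖P(re^{iφ})‖` EXCEEDS `e^{b(φ)}`, the angular derivative `−Im(z P'(z)/P(z))` of `log ‖P(re^{iφ})‖` is at
most `b'(φ)`, then `‖P(re^{iφ})‖ ≤ e^{b(φ)}` on the whole of `[φ₀, φ₁]` (sup of the last crossing + mean value theorem;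
zeros of `P` never enter since the hypothesis is only used strictly above the positive barrier). -/
theorem stub_arcBarrier :
    ∀ (P : Polynomial ℂ) (r φ₀ φ₁ : ℝ) (b b' : ℝ → ℝ), 0 < r → φ₀ ≤ φ₁ →
      (∀ φ ∈ Set.Icc φ₀ φ₁, HasDerivAt b (b' φ) φ) →
      ‖P.eval ((r : ℂ) * Complex.exp ((φ₀ : ℂ) * Complex.I))‖ ≤ Real.exp (b φ₀) →
      (∀ φ ∈ Set.Ioo φ₀ φ₁,
        Real.exp (b φ) < ‖P.eval ((r : ℂ) * Complex.exp ((φ : ℂ) * Complex.I))‖ →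
          -(((r : ℂ) * Complex.exp ((φ : ℂ) * Complex.I) *
              (Polynomial.derivative P).eval ((r : ℂ) * Complex.exp ((φ : ℂ) * Complex.I)) /
              P.eval ((r : ℂ) * Complex.exp ((φ : ℂ) * Complex.I))).im) ≤ b' φ) →
      ∀ φ ∈ Set.Icc φ₀ φ₁, ‖P.eval ((r : ℂ) * Complex.exp ((φ : ℂ) * Complex.I))‖ ≤ Real.exp (b φ) := by
  intro P r φ₀ φ₁ b b' _hr _hφ hb h0 hmain
  refine arcBarrier_path (F := fun t : ℝ => P.eval ((r : ℂ) * Complex.exp ((t : ℂ) * Complex.I)))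
    (F' := fun t : ℝ =>
      (Polynomial.derivative P).eval ((r : ℂ) * Complex.exp ((t : ℂ) * Complex.I)) *
        ((r : ℂ) * Complex.exp ((t : ℂ) * Complex.I) * Complex.I))
    (arcBarrier_hasDerivAt_eval P r) hb h0 ?_
  intro x hx hlt
  have hp : P.eval ((r : ℂ) * Complex.exp ((x : ℂ) * Complex.I)) ≠ 0 :=
    norm_pos_iff.mp ((Real.exp_pos _).trans hlt)
  show inner ℝ (P.eval ((r : ℂ) * Complex.exp ((x : ℂ) * Complex.I)))
      ((Polynomial.derivative P).eval ((r : ℂ) * Complex.exp ((x : ℂ) * Complex.I)) *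
        ((r : ℂ) * Complex.exp ((x : ℂ) * Complex.I) * Complex.I)) ≤
    ‖P.eval ((r : ℂ) * Complex.exp ((x : ℂ) * Complex.I))‖ ^ 2 * b' x
  rw [arcBarrier_inner_eq _ _ _ hp]
  exact mul_le_mul_of_nonneg_left (hmain x hx hlt) (sq_nonneg _)

end

end Summit.Parity.BatemanHorn.Cruxes.NormalFamilyBound.RenewalPhaseBootstrap
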